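import Summits.MatrixMultiplication.OmegaCensus.STPPBlockVolumeFilter
import Summits.MatrixMultiplication.OmegaCensus.STPPPatternMonotonicity

/-!
# ω-census (abelian STPP census): filter N15 — the ALIGNED BLOCK LAW (kernel)

HONEST FRAMING (pub-omega census; verbatim): lottery ticket; floor = certified bounds/negative ranges.
Census BOOKKEEPING / STRUCTURE (seat pub-omega-stpp-1 gen 27, 2026-08-27), family (b2).  A necessary condition on STPP families in finite
abelian groups — a tool for EXCLUDING candidate block patterns by theorem; nothing here is progress on `ω`.

## Statement

Let `(Aᵢ, Bᵢ, Cᵢ)_{i<N}` be an STPP family (CKSU 2005 Def. 5.1, the tree's `IsSTPP`) with non-empty sets in a finite abelian group `H`, `|H| = n`,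
card vectors `(aᵢ, bᵢ, cᵢ)`; `X_k = B_k − A_k`, `Y_k = C_k − B_k`, `Z_k = C_k − A_k` (`STPPKneserFilter.lean` §2).

**Filter N15 (aligned block law), identity reading.**  For every block `i`:
`min(aᵢ, 2)·bᵢcᵢ + Σ_{k ≠ i} (a_k + b_k)·c_k ≤ n`  (`min_card_two_mul_add_sum_le`),
and with the full volume `aᵢbᵢcᵢ` in place of `min(aᵢ,2)·bᵢcᵢ` whenever `Aᵢ` is centrally symmetric, in particular whenever `|Aᵢ| ≤ 2`
(`vol_add_sum_AC_BC_le_of_card_le_two`); the general statement is `filter_card_mul_add_sum_le` with the symmetry count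
`#{a ∈ Aᵢ : e_A + s₀ − a ∈ Aᵢ}` (`e_A, s₀ ∈ Aᵢ`) as the coefficient of `bᵢcᵢ`.  By the role symmetry of Def. 5.1 (`stpp_rotate`, `isSTPP_neg_reverse`)
the same holds for every ordered pair `(p, q)` of distinct coordinates: `min(pᵢ,2)·qᵢrᵢ + Σ_{k≠i} q_k(p_k + r_k) ≤ n` — six readings, the decidable
card-vector predicate `N15Dead` with `not_isSTPP_of_n15Dead` (same shape as `N8Dead` … `N14Dead`).  No divisor quantifier, no Kneser.

PROOF (identity reading).  Pick `e_A ∈ Aᵢ`, `e_B ∈ Bᵢ` and put `x₀ = e_B − e_A ∈ Xᵢ`.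
(1) ALIGNMENT: `x₀ + y = z` with `y ∈ Y_l`, `z ∈ Z_k` is Def. 5.1 (ii) with `x = x₀ ∈ Xᵢ`, forcing `l = k = i`; hence the translates `x₀ + Y_l` (`l ≠ i`)
and the sets `Z_k` (`k ≠ i`) are `2(N−1)` PAIRWISE DISJOINT sets of sizes `b_l c_l`, `a_k c_k` (`disjoint_translate_D_BC_D_AC`).
(2) The translated block sumset `E = {e_B + c − a − b} = (e_B − Aᵢ) + (Cᵢ − Bᵢ)` misses every `Z_k`, `k ≠ i` (pattern `(i,i,k)`; this is N14,
`disjoint_image_blockSum_DU`), and `E' = x₀ + {a − s₀ + c − b}` misses every `x₀ + Y_k`, `k ≠ i` (pattern `(i,k,i)`), for any `s₀ ∈ Aᵢ`.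
(3) `E ∩ E' ⊇ F := {e_B + c − a − b : a ∈ Aᵢ, e_A + s₀ − a ∈ Aᵢ, b ∈ Bᵢ, c ∈ Cᵢ}` (for such `a`, `e_B − a = x₀ + (a′ − s₀)` with `a′ = e_A + s₀ − a ∈ Aᵢ`),
and `|F| = #{a ∈ Aᵢ : e_A + s₀ − a ∈ Aᵢ} · bᵢcᵢ` by the TPP injectivity of `(a,b,c) ↦ e_B + c − a − b`.  So `F`, the `x₀ + Y_l` and the `Z_k` are pairwise
disjoint in `H`.  With `e_A ≠ s₀` the count is `≥ 2`; with `Aᵢ = {e_A, s₀}` it is `aᵢ`.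

RELATION TO EARLIER FILTERS.  N14 (`STPPBlockVolumeFilter.lean`) is the vol-set with ONE difference family; N15 buys the second family (`Y` next to `Z`)
with the alignment (1), at the price of the symmetry count.  For blocks with `aᵢ = 2` N15 implies N13's T2-inequality (`STPPPairDifferenceFilter.lean`):
`Σac + Σbc + (bᵢ − 2)cᵢ ≤ n` versus `Σac + Σbc + bᵢcᵢ ≤ n + 2·max c`; in particular «(2,2,c) blocks never beat» is the special case `aᵢ = bᵢ = 2`.

Measured bite (HOME `pub-omega-stpp-1-g27/n15/`, numbers only): ℤ₅₇ front of record (2 128 leaves of bundle parts-57b): alive under N7–N14 = 81 →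
under N7–N15 = **41** (N15 alone kills 1 696 / 2 128); GO #47 tier-L 29: N15-dead 26, N14 ∨ N15 29/29; engine records (17 abelian logs, orders 48–57):
1 069 of 5 588 distinct UNSAT patterns and 552 of 4 025 cores are N15-dead (ℤ₅₇: 17 of the 108 cores); the abelian `≤ 16` census: 20 of its 201
INFEASIBLE items are N15-dead (all of volume `≤ n`, e.g. `{(1,1,3),(1,1,4)}` in ℤ₁₀: `3 + 2·4 = 11 > 10`).  SOUNDNESS of the arithmetic: 0 of 568 FEASIBLE
pairs and 0 of 1 984 SAT-witnessed patterns flagged; set-level re-check of (1)–(3) on 345 SAT witness families × 6 role maps: 430 754 checks, 0 violations.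

References: H. Cohn, R. Kleinberg, B. Szegedy, C. Umans, FOCS 2005 (arXiv:math/0511460), Def. 5.1.
-/

open Finset
open scoped Pointwise

namespace Summit.MatrixMultiplication.OmegaCensus.CubeNB

open Literature.Computability.AlgebraicComplexity
open Summit.MatrixMultiplication.OmegaCensus.STPPKneser

variable {H : Type*} [AddCommGroup H] [DecidableEq H] [Fintype H] {N : ℕ} {A B C : Fin N → Finset H}

/-! ## §1 Alignment and the aligned block law -/

section Law

omit [Fintype H] in
/-- **Alignment.**  For `e_A ∈ Aᵢ`, `e_B ∈ Bᵢ` (so `x₀ = e_B − e_A ∈ Xᵢ`) the translate `x₀ + Y_l` and the set `Z_k` are disjoint unless `l = k = i`: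
`x₀ + y = z` is Def. 5.1 (ii) with `x = x₀ ∈ Xᵢ` (`indices_eq_of_add_eq`). [cite: CohnKleinbergSzegedyUmans2005, Def. 5.1] -/
theorem disjoint_translate_D_BC_D_AC (hS : IsSTPP A B C) {i l k : Fin N} (hlk : ¬(l = i ∧ k = i)) {eA eB : H}
    (heA : eA ∈ A i) (heB : eB ∈ B i) :
    Disjoint ((D B C l).image fun y => eB - eA + y) (D A C k) := by
  rw [Finset.disjoint_left]
  intro w hw hz
  obtain ⟨y, hy, rfl⟩ := Finset.mem_image.1 hw
  have hx : eB - eA ∈ D A B i := mem_D.2 ⟨eA, heA, eB, heB, rfl⟩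
  obtain ⟨hik, hlk'⟩ := indices_eq_of_add_eq hS hx hy hz rfl
  exact hlk ⟨hlk'.trans hik.symm, hik.symm⟩

omit [Fintype H] in
/-- The translated union `x₀ + ⋃_{l ≠ i} Y_l` and `⋃_{k ≠ i} Z_k` are disjoint (alignment, block by block). [cite: CohnKleinbergSzegedyUmans2005, Def. 5.1] -/
theorem disjoint_translate_DU_BC_DU_AC (hS : IsSTPP A B C) (i : Fin N) {eA eB : H} (heA : eA ∈ A i) (heB : eB ∈ B i) :
    Disjoint ((DU B C (univ.erase i)).image fun y => eB - eA + y) (DU A C (univ.erase i)) := by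
  rw [Finset.disjoint_left]
  intro w hw hz
  obtain ⟨y, hy, rfl⟩ := Finset.mem_image.1 hw
  obtain ⟨l, hl, hyl⟩ := Finset.mem_biUnion.1 hy
  obtain ⟨k, hk, hzk⟩ := Finset.mem_biUnion.1 hz
  have hd := disjoint_translate_D_BC_D_AC hS (i := i) (l := l) (k := k)
    (fun h => (Finset.mem_erase.1 hl).1 h.1) heA heB
  exact Finset.disjoint_left.1 hd (Finset.mem_image.2 ⟨y, hyl, rfl⟩) hzk

omit [Fintype H] in
/-- The restricted translated block sumset `F = {e_B + c − a − b : a ∈ S, b ∈ Bᵢ, c ∈ Cᵢ}` (`S ⊆ Aᵢ`) has `|S|·|Bᵢ|·|Cᵢ|` elements (TPP injectivity of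
block `i`, as in `card_image_blockSum`). [cite: CohnKleinbergSzegedyUmans2005, Def. 5.1] -/
theorem card_image_blockSum_subset (hS : IsSTPP A B C) (i : Fin N) (eB : H) {S : Finset H} (hSA : S ⊆ A i) :
    #((S ×ˢ ((B i) ×ˢ (C i))).image fun q : H × H × H => eB + q.2.2 - q.1 - q.2.1) = #S * #(B i) * #(C i) := by
  rw [Finset.card_image_of_injOn, Finset.card_product, Finset.card_product, mul_assoc]
  rintro ⟨a, b, c⟩ hq ⟨a', b', c'⟩ hq' (heq : eB + c - a - b = eB + c' - a' - b')
  simp only [Finset.coe_product, Set.mem_prod, Finset.mem_coe] at hq hq'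
  have hrel : (a' - a) + (b' - b) + (c - c') = 0 := by
    have h' := sub_eq_zero.2 heq
    rw [← h']; abel
  obtain ⟨-, -, h1, h2, h3⟩ :=
    hS i i i a (hSA hq.1) a' (hSA hq'.1) b hq.2.1 b' hq'.2.1 c' hq'.2.2 c hq.2.2 hrel
  rw [h1, h2, h3]

omit [Fintype H] in
/-- With `S = {a ∈ Aᵢ : e_A + s₀ − a ∈ Aᵢ}` the restricted sumset `F` misses every translate `x₀ + Y_k`, `k ≠ i` (`x₀ = e_B − e_A`): an equality
`e_B + c − a − b = x₀ + (c_k − b_k)` is the Def-5.1 relation `(a′ − s₀) + (b_k − b) + (c − c_k) = 0` of pattern `(i, k, i)` with `a′ = e_A + s₀ − a ∈ Aᵢ`,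
forcing `k = i`. [cite: CohnKleinbergSzegedyUmans2005, Def. 5.1] -/
theorem disjoint_image_blockSum_translate_DU (hS : IsSTPP A B C) (i : Fin N) {eA eB s₀ : H} (hs₀ : s₀ ∈ A i) :
    Disjoint ((((A i).filter fun a => eA + s₀ - a ∈ A i) ×ˢ ((B i) ×ˢ (C i))).image
        fun q : H × H × H => eB + q.2.2 - q.1 - q.2.1)
      ((DU B C (univ.erase i)).image fun y => eB - eA + y) := by
  rw [Finset.disjoint_left]
  intro w hw hw'
  obtain ⟨⟨a, b, c⟩, hq, rfl⟩ := Finset.mem_image.1 hw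
  simp only [Finset.mem_product, Finset.mem_filter] at hq
  obtain ⟨⟨-, ha'⟩, hb, hc⟩ := hq
  obtain ⟨y, hy, hyw⟩ := Finset.mem_image.1 hw'
  obtain ⟨k, hk, hyk⟩ := Finset.mem_biUnion.1 hy
  obtain ⟨bk, hbk, ck, hck, rfl⟩ := mem_D.1 hyk
  have hrel : (eA + s₀ - a - s₀) + (bk - b) + (c - ck) = 0 := by
    have h' := sub_eq_zero.2 hyw
    rw [← neg_eq_zero, ← h']; abel
  obtain ⟨hik, -, -, -, -⟩ := hS i k i s₀ hs₀ (eA + s₀ - a) ha' b hb bk hbk ck hck c hc hrel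
  exact (Finset.mem_erase.1 hk).1 hik.symm

/-- **N15, general identity reading.**  For an STPP family with non-empty `A`- and `B`-sets in a finite abelian group, a block `i` and `e_A, s₀ ∈ Aᵢ`:
`#{a ∈ Aᵢ : e_A + s₀ − a ∈ Aᵢ}·|Bᵢ||Cᵢ| + Σ_{k ≠ i} (|A_k||C_k| + |B_k||C_k|) ≤ |H|` — the restricted block sumset, the aligned translates `x₀ + Y_k` and the sets
`Z_k` (`k ≠ i`) are pairwise disjoint subsets of `H`. [cite: CohnKleinbergSzegedyUmans2005, Def. 5.1] -/
theorem filter_card_mul_add_sum_le (hS : IsSTPP A B C) (hA : ∀ i, (A i).Nonempty) (hB : ∀ i, (B i).Nonempty) (i : Fin N)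
    {eA s₀ : H} (heA : eA ∈ A i) (hs₀ : s₀ ∈ A i) :
    #((A i).filter fun a => eA + s₀ - a ∈ A i) * #(B i) * #(C i) +
      ∑ k ∈ univ.erase i, (#(A k) * #(C k) + #(B k) * #(C k)) ≤ Fintype.card H := by
  obtain ⟨eB, heB⟩ := hB i
  set F := (((A i).filter fun a => eA + s₀ - a ∈ A i) ×ˢ ((B i) ×ˢ (C i))).image
      fun q : H × H × H => eB + q.2.2 - q.1 - q.2.1 with hF
  set T := (DU B C (univ.erase i)).image fun y => eB - eA + y with hT
  set Z := DU A C (univ.erase i) with hZ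
  have hcF : #F = #((A i).filter fun a => eA + s₀ - a ∈ A i) * #(B i) * #(C i) :=
    card_image_blockSum_subset hS i eB (Finset.filter_subset _ _)
  have hcT : #T = ∑ k ∈ univ.erase i, #(B k) * #(C k) := by
    rw [hT, Finset.card_image_of_injective _ (add_right_injective (eB - eA)), card_DU_BC hS hA]
  have hcZ : #Z = ∑ k ∈ univ.erase i, #(A k) * #(C k) := card_DU_AC hS hB _
  have hFT : Disjoint F T := disjoint_image_blockSum_translate_DU hS i hs₀
  have hFZ : Disjoint F Z := by
    refine Disjoint.mono_left ?_ (disjoint_image_blockSum_DU hS i heB)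
    exact Finset.image_subset_image (Finset.product_subset_product_left (Finset.filter_subset _ _))
  have hTZ : Disjoint T Z := disjoint_translate_DU_BC_DU_AC hS i heA heB
  have hunion : #(F ∪ T ∪ Z) = #F + #T + #Z := by
    rw [Finset.card_union_of_disjoint (Finset.disjoint_union_left.2 ⟨hFZ, hTZ⟩),
      Finset.card_union_of_disjoint hFT]
  rw [Finset.sum_add_distrib, ← hcF, ← hcZ, ← hcT]
  calc #F + (#Z + #T) = #(F ∪ T ∪ Z) := by rw [hunion]; ring
    _ ≤ Fintype.card H := Finset.card_le_univ _

/-- **N15 (aligned block law), card form, identity reading.**  For an STPP family with non-empty `A`- and `B`-sets and every block `i`: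
`min(|Aᵢ|, 2)·|Bᵢ||Cᵢ| + Σ_{k ≠ i} (|A_k| + |B_k|)·|C_k| ≤ |H|`  (two points `e_A ≠ s₀` of `Aᵢ` give symmetry count `≥ 2`; a singleton `Aᵢ` gives `1`).
[cite: CohnKleinbergSzegedyUmans2005, Def. 5.1] -/
theorem min_card_two_mul_add_sum_le (hS : IsSTPP A B C) (hA : ∀ i, (A i).Nonempty) (hB : ∀ i, (B i).Nonempty) (i : Fin N) :
    min #(A i) 2 * #(B i) * #(C i) + ∑ k ∈ univ.erase i, (#(A k) + #(B k)) * #(C k) ≤ Fintype.card H := by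
  obtain ⟨eA, heA⟩ := hA i
  have hsum : ∑ k ∈ univ.erase i, (#(A k) + #(B k)) * #(C k) = ∑ k ∈ univ.erase i, (#(A k) * #(C k) + #(B k) * #(C k)) :=
    Finset.sum_congr rfl fun k _ => add_mul _ _ _
  by_cases h2 : ∃ s₀ ∈ A i, s₀ ≠ eA
  · obtain ⟨s₀, hs₀, hne⟩ := h2
    have hle : min #(A i) 2 ≤ #((A i).filter fun a => eA + s₀ - a ∈ A i) := by
      have hsub : ({eA, s₀} : Finset H) ⊆ (A i).filter fun a => eA + s₀ - a ∈ A i := by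
        intro a ha
        rcases Finset.mem_insert.1 ha with rfl | ha
        · exact Finset.mem_filter.2 ⟨heA, by rwa [add_sub_cancel_left]⟩
        · rw [Finset.mem_singleton.1 ha]
          exact Finset.mem_filter.2 ⟨hs₀, by rwa [add_sub_cancel_right]⟩
      have := Finset.card_le_card hsub
      rw [Finset.card_pair hne.symm] at this
      omega
    have hmain := filter_card_mul_add_sum_le hS hA hB i heA hs₀
    rw [hsum]
    exact le_trans (Nat.add_le_add_right (Nat.mul_le_mul_right _ (Nat.mul_le_mul_right _ hle)) _) hmain
  · push Not at h2
    have hA1 : A i = {eA} := Finset.eq_singleton_iff_unique_mem.2 ⟨heA, h2⟩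
    have hc1 : #(A i) = 1 := by rw [hA1, Finset.card_singleton]
    have hle : min #(A i) 2 ≤ #((A i).filter fun a => eA + eA - a ∈ A i) := by
      have hmem : eA ∈ (A i).filter fun a => eA + eA - a ∈ A i :=
        Finset.mem_filter.2 ⟨heA, by rwa [add_sub_cancel_right]⟩
      have h1 : 1 ≤ #((A i).filter fun a => eA + eA - a ∈ A i) := Finset.card_pos.2 ⟨eA, hmem⟩
      have hmin : min #(A i) 2 = 1 := by rw [hc1]; norm_num
      rw [hmin]
      exact h1
    have hmain := filter_card_mul_add_sum_le hS hA hB i heA heA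
    rw [hsum]
    exact le_trans (Nat.add_le_add_right (Nat.mul_le_mul_right _ (Nat.mul_le_mul_right _ hle)) _) hmain

/-- **N15 with the full volume for `|Aᵢ| ≤ 2`.**  If `|Aᵢ| ≤ 2` (a centrally symmetric pair or a singleton) then
`|Aᵢ||Bᵢ||Cᵢ| + Σ_{k ≠ i} (|A_k| + |B_k|)·|C_k| ≤ |H|`. [cite: CohnKleinbergSzegedyUmans2005, Def. 5.1] -/
theorem vol_add_sum_AC_BC_le_of_card_le_two (hS : IsSTPP A B C) (hA : ∀ i, (A i).Nonempty) (hB : ∀ i, (B i).Nonempty)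
    (i : Fin N) (h2 : #(A i) ≤ 2) :
    #(A i) * #(B i) * #(C i) + ∑ k ∈ univ.erase i, (#(A k) + #(B k)) * #(C k) ≤ Fintype.card H := by
  have h := min_card_two_mul_add_sum_le hS hA hB i
  rwa [min_eq_left h2] at h

end Law

/-! ## §2 The decidable card-vector predicate (six readings) and the filter theorem -/

section Filter

/-- **Filter N15, one reading**, on the card vectors `(a, b, c)` of a pattern in a group of order `n`: some block `i` has
`min(aᵢ,2)·bᵢcᵢ + Σ_{k≠i} (a_k + b_k)c_k > n`.  Same verdicts as HOME `pub-omega-stpp-1-g27/code/n15_filter.py`, reading `(p,q,r) = (A,C,B)`. [folklore] -/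
def N15Dead1 (n N : ℕ) (a b c : Fin N → ℕ) : Bool :=
  decide (∃ i : Fin N, n < min (a i) 2 * b i * c i + ∑ k ∈ univ.erase i, (a k + b k) * c k)

/-- **Filter N15** on the card vectors: `N15Dead1` for one of the SIX role permutations `(a,b,c)`, `(b,c,a)`, `(c,a,b)` (rotations) and `(c,b,a)`,
`(b,a,c)`, `(a,c,b)` (reflections) — all ordered pairs `(p, q)` of distinct coordinates. [folklore] -/
def N15Dead (n N : ℕ) (a b c : Fin N → ℕ) : Bool :=
  N15Dead1 n N a b c || N15Dead1 n N b c a || N15Dead1 n N c a b ||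
    N15Dead1 n N c b a || N15Dead1 n N b a c || N15Dead1 n N a c b

/-- **Filter N15, one reading (kernel).**  An STPP family with non-empty `A`- and `B`-sets whose card vectors satisfy `N15Dead1 |H|` does not exist.
[cite: CohnKleinbergSzegedyUmans2005, Def. 5.1] -/
theorem not_isSTPP_of_n15Dead1 (hS : IsSTPP A B C) (hA : ∀ i, (A i).Nonempty) (hB : ∀ i, (B i).Nonempty) {n : ℕ}
    (hn : Fintype.card H = n) {a b c : Fin N → ℕ} (ha : ∀ i, #(A i) = a i) (hb : ∀ i, #(B i) = b i)
    (hc : ∀ i, #(C i) = c i) (hdead : N15Dead1 n N a b c = true) : False := by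
  obtain ⟨i, hlt⟩ := of_decide_eq_true hdead
  have h := min_card_two_mul_add_sum_le hS hA hB i
  rw [hn, ha, hb, hc] at h
  have e : ∑ k ∈ univ.erase i, (#(A k) + #(B k)) * #(C k) = ∑ k ∈ univ.erase i, (a k + b k) * c k :=
    Finset.sum_congr rfl fun k _ => by rw [ha, hb, hc]
  rw [e] at h
  omega

omit [Fintype H] in
/-- Cardinalities of the negated family `(−Cᵢ)`. [folklore] -/
theorem card_neg_family (E : Fin N → Finset H) (i : Fin N) : #((fun j => -(E j)) i) = #(E i) := by
  simp only [Finset.card_neg]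

omit [Fintype H] in
/-- Non-emptiness of the negated family. [folklore] -/
theorem nonempty_neg_family {E : Fin N → Finset H} (hE : ∀ i, (E i).Nonempty) (i : Fin N) : ((fun j => -(E j)) i).Nonempty :=
  (hE i).neg

/-- **Filter N15 (kernel): an STPP family with non-empty sets in a finite abelian group `H` whose pattern `(|Aᵢ|,|Bᵢ|,|Cᵢ|)ᵢ` is `N15Dead |H|` does not
exist** — the six readings via `stpp_rotate` and `isSTPP_neg_reverse`. [cite: CohnKleinbergSzegedyUmans2005, Def. 5.1] -/
theorem not_isSTPP_of_n15Dead (hS : IsSTPP A B C) (hA : ∀ i, (A i).Nonempty) (hB : ∀ i, (B i).Nonempty)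
    (hC : ∀ i, (C i).Nonempty) {n : ℕ} (hn : Fintype.card H = n) {a b c : Fin N → ℕ} (ha : ∀ i, #(A i) = a i)
    (hb : ∀ i, #(B i) = b i) (hc : ∀ i, #(C i) = c i) (hdead : N15Dead n N a b c = true) : False := by
  simp only [N15Dead, Bool.or_eq_true] at hdead
  have hR := isSTPP_neg_reverse hS
  have hnA : ∀ i, #((fun j => -(A j)) i) = a i := fun i => by rw [card_neg_family, ha]
  have hnB : ∀ i, #((fun j => -(B j)) i) = b i := fun i => by rw [card_neg_family, hb]
  have hnC : ∀ i, #((fun j => -(C j)) i) = c i := fun i => by rw [card_neg_family, hc]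
  rcases hdead with ((((h | h) | h) | h) | h) | h
  · exact not_isSTPP_of_n15Dead1 hS hA hB hn ha hb hc h
  · exact not_isSTPP_of_n15Dead1 (stpp_rotate hS) hB hC hn hb hc ha h
  · exact not_isSTPP_of_n15Dead1 (stpp_rotate (stpp_rotate hS)) hC hA hn hc ha hb h
  · exact not_isSTPP_of_n15Dead1 hR (nonempty_neg_family hC) (nonempty_neg_family hB) hn hnC hnB hnA h
  · exact not_isSTPP_of_n15Dead1 (stpp_rotate hR) (nonempty_neg_family hB) (nonempty_neg_family hA) hn hnB hnA hnC h
  · exact not_isSTPP_of_n15Dead1 (stpp_rotate (stpp_rotate hR)) (nonempty_neg_family hA) (nonempty_neg_family hC)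
      hn hnA hnC hnB h

/-- Card-vector form with literal vectors: non-emptiness from positivity of the entries. [cite: CohnKleinbergSzegedyUmans2005, Def. 5.1] -/
theorem not_isSTPP_of_n15Dead' (hS : IsSTPP A B C) {n : ℕ} (hn : Fintype.card H = n) (a b c : Fin N → ℕ)
    (ha : ∀ i, #(A i) = a i) (hb : ∀ i, #(B i) = b i) (hc : ∀ i, #(C i) = c i)
    (hpos : ∀ i, 0 < a i ∧ 0 < b i ∧ 0 < c i) (hdead : N15Dead n N a b c = true) : False :=
  not_isSTPP_of_n15Dead hS (fun i => card_pos.1 ((ha i).symm ▸ (hpos i).1))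
    (fun i => card_pos.1 ((hb i).symm ▸ (hpos i).2.1)) (fun i => card_pos.1 ((hc i).symm ▸ (hpos i).2.2))
    hn ha hb hc hdead

end Filter

/-! ## §3 Examples -/

section Examples

/-- A leaf of the ℤ₅₇ front of record alive under every filter N7–N14, `{(2,2,4), (2,2,4), (2,7,2)}` (`Σ abc = 60 > 57`, two `C`-long and one `B`-long
`(2,2,c)`-type blocks in mixed orientation, outside N13's class), carries no STPP family in ANY abelian group of order `57`: N15 at the `(2,7,2)` block,
identity reading `(p,q) = (A,C)`: `min(2,2)·7·2 + (2+2)·4 + (2+2)·4 = 28 + 32 = 60 > 57`. [cite: CohnKleinbergSzegedyUmans2005, Def. 5.1] -/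
theorem no_isSTPP_Z57_224_224_272 (hH : Fintype.card H = 57) (A B C : Fin 3 → Finset H) (hS : IsSTPP A B C)
    (hA : ∀ i, #(A i) = ![2, 2, 2] i) (hB : ∀ i, #(B i) = ![2, 2, 7] i) (hC : ∀ i, #(C i) = ![4, 4, 2] i) : False :=
  not_isSTPP_of_n15Dead' hS hH _ _ _ hA hB hC (by decide) (by decide +kernel)

/-- A NON-beating infeasibility re-derived by theorem: the abelian `≤ 16` census (stpp-2 / ttrl Engine C, DFS + SAT ×2) lists `{(1,1,3), (1,1,4)}` as
INFEASIBLE in ℤ₁₀ (item `Z10:INFEASIBLE:113_114`, volume `7 < 10`); N15 gives it in any abelian group of order `10`: `1·1·3 + (1+1)·4 = 11 > 10`.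
[cite: CohnKleinbergSzegedyUmans2005, Def. 5.1] -/
theorem no_isSTPP_card10_113_114 (hH : Fintype.card H = 10) (A B C : Fin 2 → Finset H) (hS : IsSTPP A B C)
    (hA : ∀ i, #(A i) = ![1, 1] i) (hB : ∀ i, #(B i) = ![1, 1] i) (hC : ∀ i, #(C i) = ![3, 4] i) : False :=
  not_isSTPP_of_n15Dead' hS hH _ _ _ hA hB hC (by decide) (by decide +kernel)

end Examples

end Summit.MatrixMultiplication.OmegaCensus.CubeNB
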